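import Literature.NumberTheory.DiophantineApproximation.PolylogTwoPointHermitePadeSeries
import Mathlib.Topology.Algebra.InfiniteSum.NatInt
import HarnessLib

/-!
# The parity bridge `Li_s(±1/N) = 2^{-s} Li_s(1/N²) ± N Θ_s(1/N²)`

Topic `Literature/NumberTheory/DiophantineApproximation`. The reduction of the TWO-point case of
David–Hirata-Kohno–Kawashima 2020, Thm 2.1 (`1, Li_s(1/N), Li_s(−1/N)`, `s ≤ w`, linearly
independent over `ℚ` for large `N`) to a ONE-point problem in `y = 1/N²` with the two series
`Li_s(y) = ∑_{k ≥ 1} y^k/k^s` (`DilogPade.polylogSeries s y`) and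
`Θ_s(y) = ∑_{k ≥ 0} y^{k+1}/(2k+1)^s` (`ParityPade.oddPolylogSeries s y`, vocabulary file
`PolylogTwoPointHermitePade.lean`):

* `polylogSeries_one_div_eq` — `Li_s(1/N) = 2^{-s} Li_s(1/N²) + N Θ_s(1/N²)` for `N ≥ 2`;
* `polylogSeries_neg_one_div_eq` — `Li_s(−1/N) = 2^{-s} Li_s(1/N²) − N Θ_s(1/N²)` for `N ≥ 2`.

The computation: split `Li_s(x) = ∑_{k ≥ 0} x^{k+1}/(k+1)^s` (`x = ±1/N`, absolutely convergent)
into the terms of even and odd index `k` (`tsum_even_add_odd`). For `k = 2j` the term is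
`x^{2j+1}/(2j+1)^s = ± N · y^{j+1}/(2j+1)^s` (`x^{2j+1} = ± N^{-2j-1} = ± N y^{j+1}`), summing to
`± N Θ_s(y)`; for `k = 2j+1` it is `x^{2j+2}/(2j+2)^s = y^{j+1}/(2^s (j+1)^s)`, summing to
`2^{-s} Li_s(y)`.

References: S. David, N. Hirata-Kohno, M. Kawashima, *Can polylogarithms at algebraic points be
linearly independent?*, Moscow J. Comb. Number Th. 9 (2020), Thm 2.1 (the case `α = (1, −1)`).
Everything here is PROVED from Mathlib's `tsum` API and `DilogHermitePadeSeries.lean`; no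
definitions, no named facts.
-/

noncomputable section

namespace Literature.NumberTheory.DiophantineApproximation

namespace ParityPade

open Literature.NumberTheory.Transcendental

/-- The even-index terms of `Li_s(1/N)`: `(1/N)^{2j+1}/(2j+1)^s = N · (1/N²)^{j+1}/(2j+1)^s`.
[folklore] -/
private theorem parity_term_even (s : ℕ) {N : ℕ} (hN : 2 ≤ N) (j : ℕ) :
    (1 / (N : ℝ)) ^ (2 * j + 1) / (((2 * j : ℕ) : ℝ) + 1) ^ s =
      (N : ℝ) * ((1 / ((N : ℝ) ^ 2)) ^ (j + 1) / (2 * (j : ℝ) + 1) ^ s) := by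
  have hN0 : (N : ℝ) ≠ 0 := by positivity
  have hj : 2 * (j + 1) = 2 * j + 1 + 1 := by ring
  have hc : ((2 * j : ℕ) : ℝ) + 1 = 2 * (j : ℝ) + 1 := by push_cast; ring
  have h : (N : ℝ) * (1 / ((N : ℝ) ^ 2)) ^ (j + 1) = (1 / (N : ℝ)) ^ (2 * j + 1) := by
    rw [← one_div_pow, ← pow_mul, hj, pow_succ _ (2 * j + 1), mul_left_comm, one_div,
      mul_inv_cancel₀ hN0, mul_one]
  rw [hc, ← mul_div_assoc, h]

/-- The odd-index terms of `Li_s(1/N)`: `(1/N)^{2j+2}/(2j+2)^s = ((1/N²)^{j+1}/(j+1)^s)/2^s`.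
[folklore] -/
private theorem parity_term_odd (s N j : ℕ) :
    (1 / (N : ℝ)) ^ (2 * j + 1 + 1) / (((2 * j + 1 : ℕ) : ℝ) + 1) ^ s =
      (1 / ((N : ℝ) ^ 2)) ^ (j + 1) / ((j : ℝ) + 1) ^ s / 2 ^ s := by
  have h2 : ((2 * j + 1 : ℕ) : ℝ) + 1 = 2 * ((j : ℝ) + 1) := by push_cast; ring
  have hj : 2 * j + 1 + 1 = 2 * (j + 1) := by ring
  rw [h2, hj, mul_pow, pow_mul, one_div_pow, div_div, mul_comm]

/-- Summability of the even-index terms of `Li_s(1/N)` (`N ≥ 2`): a subseries of the absolutely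
convergent series `∑_k N^{-k-1}/(k+1)^s`. [folklore] -/
private theorem parity_summable_even (s : ℕ) {N : ℕ} (hN : 2 ≤ N) :
    Summable fun j : ℕ => (1 / (N : ℝ)) ^ (2 * j + 1) / (((2 * j : ℕ) : ℝ) + 1) ^ s := by
  have h1 : (1 : ℝ) < N := by exact_mod_cast hN
  have hx1 : 1 / (N : ℝ) < 1 := by rw [div_lt_one (by positivity)]; exact h1
  exact (DilogPade.summable_polylogSeries s (by positivity) hx1).comp_injective
    (i := fun j : ℕ => 2 * j) (mul_right_injective₀ two_ne_zero)

/-- Summability of the odd-index terms of `Li_s(1/N)` (`N ≥ 2`): a subseries of the absolutely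
convergent series `∑_k N^{-k-1}/(k+1)^s`. [folklore] -/
private theorem parity_summable_odd (s : ℕ) {N : ℕ} (hN : 2 ≤ N) :
    Summable fun j : ℕ => (1 / (N : ℝ)) ^ (2 * j + 1 + 1) / (((2 * j + 1 : ℕ) : ℝ) + 1) ^ s := by
  have h1 : (1 : ℝ) < N := by exact_mod_cast hN
  have hx1 : 1 / (N : ℝ) < 1 := by rw [div_lt_one (by positivity)]; exact h1
  exact (DilogPade.summable_polylogSeries s (by positivity) hx1).comp_injective
    (i := fun j : ℕ => 2 * j + 1)
    ((add_left_injective 1).comp (mul_right_injective₀ two_ne_zero))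

/-- The even-index part of `Li_s(1/N)` is `N Θ_s(1/N²)`. [folklore] -/
private theorem parity_tsum_even (s : ℕ) {N : ℕ} (hN : 2 ≤ N) :
    ∑' j : ℕ, (1 / (N : ℝ)) ^ (2 * j + 1) / (((2 * j : ℕ) : ℝ) + 1) ^ s =
      (N : ℝ) * oddPolylogSeries s (1 / ((N : ℝ) ^ 2)) := by
  rw [oddPolylogSeries, ← tsum_mul_left]
  exact tsum_congr fun j => parity_term_even s hN j

/-- The odd-index part of `Li_s(1/N)` is `2^{-s} Li_s(1/N²)`. [folklore] -/
private theorem parity_tsum_odd (s N : ℕ) :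
    ∑' j : ℕ, (1 / (N : ℝ)) ^ (2 * j + 1 + 1) / (((2 * j + 1 : ℕ) : ℝ) + 1) ^ s =
      DilogPade.polylogSeries s (1 / ((N : ℝ) ^ 2)) / 2 ^ s := by
  rw [DilogPade.polylogSeries, ← tsum_div_const]
  exact tsum_congr fun j => parity_term_odd s N j

/-- **The parity bridge at `1/N`** (David–Hirata-Kohno–Kawashima 2020, the reduction behind the
two-point case `α = (1, −1)` of Thm 2.1): for every integer `N ≥ 2` and every `s`,
`Li_s(1/N) = 2^{-s} Li_s(1/N²) + N Θ_s(1/N²)`, where `Li_s = DilogPade.polylogSeries s` and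
`Θ_s = oddPolylogSeries s` (split `∑_k N^{-k-1}/(k+1)^s` into even and odd `k`).
[cite: DavidHirataKohnoKawashima2020, Thm 2.1] -/
theorem polylogSeries_one_div_eq (s : ℕ) {N : ℕ} (hN : 2 ≤ N) :
    DilogPade.polylogSeries s (1 / (N : ℝ)) =
      DilogPade.polylogSeries s (1 / ((N : ℝ) ^ 2)) / 2 ^ s +
        (N : ℝ) * oddPolylogSeries s (1 / ((N : ℝ) ^ 2)) := by
  rw [← parity_tsum_odd s N, ← parity_tsum_even s hN, add_comm, DilogPade.polylogSeries]
  exact (tsum_even_add_odd (f := fun k : ℕ => (1 / (N : ℝ)) ^ (k + 1) / ((k : ℝ) + 1) ^ s)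
    (parity_summable_even s hN) (parity_summable_odd s hN)).symm

/-- **The parity bridge at `−1/N`** (David–Hirata-Kohno–Kawashima 2020, the reduction behind the
two-point case `α = (1, −1)` of Thm 2.1): for every integer `N ≥ 2` and every `s`,
`Li_s(−1/N) = 2^{-s} Li_s(1/N²) − N Θ_s(1/N²)`, where `Li_s = DilogPade.polylogSeries s` and
`Θ_s = oddPolylogSeries s` (the odd powers of `−1/N` change sign, the even ones do not).
[cite: DavidHirataKohnoKawashima2020, Thm 2.1] -/
theorem polylogSeries_neg_one_div_eq (s : ℕ) {N : ℕ} (hN : 2 ≤ N) :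
    DilogPade.polylogSeries s (-(1 / (N : ℝ))) =
      DilogPade.polylogSeries s (1 / ((N : ℝ) ^ 2)) / 2 ^ s -
        (N : ℝ) * oddPolylogSeries s (1 / ((N : ℝ) ^ 2)) := by
  have heven : ∀ j : ℕ, (-(1 / (N : ℝ))) ^ (2 * j + 1) / (((2 * j : ℕ) : ℝ) + 1) ^ s =
      -((1 / (N : ℝ)) ^ (2 * j + 1) / (((2 * j : ℕ) : ℝ) + 1) ^ s) := fun j => by
    rw [Odd.neg_pow (odd_two_mul_add_one j), neg_div]
  have hodd : ∀ j : ℕ, (-(1 / (N : ℝ))) ^ (2 * j + 1 + 1) / (((2 * j + 1 : ℕ) : ℝ) + 1) ^ s =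
      (1 / (N : ℝ)) ^ (2 * j + 1 + 1) / (((2 * j + 1 : ℕ) : ℝ) + 1) ^ s := fun j => by
    rw [Even.neg_pow ⟨j + 1, by ring⟩]
  have he : Summable fun j : ℕ =>
      (-(1 / (N : ℝ))) ^ (2 * j + 1) / (((2 * j : ℕ) : ℝ) + 1) ^ s :=
    (parity_summable_even s hN).neg.congr fun j => (heven j).symm
  have ho : Summable fun j : ℕ =>
      (-(1 / (N : ℝ))) ^ (2 * j + 1 + 1) / (((2 * j + 1 : ℕ) : ℝ) + 1) ^ s :=
    (parity_summable_odd s hN).congr fun j => (hodd j).symm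
  rw [sub_eq_add_neg, ← parity_tsum_odd s N, ← parity_tsum_even s hN, ← tsum_neg,
    ← tsum_congr hodd, ← tsum_congr heven, add_comm, DilogPade.polylogSeries]
  exact (tsum_even_add_odd (f := fun k : ℕ => (-(1 / (N : ℝ))) ^ (k + 1) / ((k : ℝ) + 1) ^ s)
    he ho).symm

end ParityPade

end Literature.NumberTheory.DiophantineApproximation
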